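import Literature.NumberTheory.Automorphic.HeckeEigenvectorProjection
import HarnessLib

/-!
# A closed invariant subspace carrying a DENSE IRREDUCIBLE GERM with a finite-rank intertwined idempotent-like operator is topologically
# irreducible (elementary Hilbert-space lemma; theorems only)

Topic `NumberTheory/Automorphic`; namespace `ContRepresentation.ClosedSubrep` (the home of the tree's closed-subrepresentation API ★
`HilbertRepSpectrum.lean` ∕ ★ `HeckeEigenvectorProjection.lean`: `ClosedSubrep`, `orthogonal`, `IsTopIrreducible`, `isTopIrreducible_toContRep_iff`).
KERNEL ONLY: theorems; no definition, no named fact, no `sorry`, no instance.  Cell hodgecm-mathlib, FLOOR 0, half A line LD1 (socket `stub_S1_facts`, #73),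
LD1-plan (g2) DEALS #1 plate «D-LEMMA» = ORGAN (D) «DENSE-GERM IRREDUCIBILITY» of the in-house road for the letter (I′) `stub_letter_thetaIrr :
ThetaSpaceIrreducible₂` (irreducibility of the closed `(a′, ξ)`-theta span; [Liu2021, (4.4)] ∕ [Wu2013, Thm. 5.3]); seat LD1-p01 (g2); `--supports stmt-HodgeConjecture-24832`.

THE LEMMA (`ContRepresentation.ClosedSubrep.isTopIrreducible_of_denseGerm`).  Let `π` be a UNITARY representation of a group `G` on a Hilbert space `V`, `W` a
closed invariant subspace, `S` a `ℂ`-module and `T : S →ₗ[ℂ] V` linear with `W ⊆ cl T(S)` (e.g. `T(S) ⊆ W` dense in `W`; the inclusion `T(S) ⊆ W` itself is NOT needed).  Assume the GERM IRREDUCIBILITY through `T`: for every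
closed invariant `Q`, either `T(S) ⊆ Q` or `T⁻¹(Q) = 0`.  Let `E : V →L[ℂ] V` map every closed invariant subspace into itself, and `e : S →ₗ[ℂ] S` with
`T ∘ e = E ∘ T`, `range e` finite-dimensional, `E|_W ≠ 0`.  THEN `W` is topologically irreducible.
PROOF.  `W ≠ 0` since `E w ≠ 0` for some `w ∈ W`.  Let `Q ≤ W` be closed invariant, `p` the orthogonal projection onto `Q`; `Qᗮ` is closed invariant
(`π` unitary, ★ `ClosedSubrep.orthogonal`).  By the germ dichotomy for `Q` and for `Qᗮ`: if `T(S) ⊆ Q` then `W = cl T(S) ⊆ Q`, so `Q = W`; if `T(S) ⊆ Qᗮ` then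
`Q ⊆ W ⊆ Qᗮ`, so `Q = 0`.  Otherwise `T⁻¹(Q) = T⁻¹(Qᗮ) = 0`, i.e. `p ∘ T` and `(1 − p) ∘ T` are injective on `S`.  Since `E` preserves `Q` and `Qᗮ`, `pE = Ep`.
Put `R := T(e(S)) = E(T(S))`, a finite-dimensional (hence closed) subspace of `W`; `E(W) ⊆ cl E(T(S)) = R`, so `pR = Ep(T e S) ⊆ E(W) ⊆ R` and likewise
`(1−p)R ⊆ R`; but `dim pR = dim e(S) ≥ dim R` (injectivity), so `pR = R = (1−p)R`, whence `R ⊆ Q ∩ Qᗮ = 0`, `E(W) = 0` — contradiction.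

ED. 2 (append-only): `isTopIrreducible_of_denseSubmoduleGerm` — the SAME in the binder shape of LD1-plan (g2)'s organ `DenseGermIrreducibility` (germ = a
submodule `S ≤ V` with `closure S = W`, `S ≤ Q ∨ S ⊓ Q = ⊥`, `E(S) ⊆ S`, `E(S)` finite-dimensional, `E|_S ≠ 0`), so that the skeleton's `stub_denseGerm` closes by one `fun … =>` line.

USE (LD1-plan (g2) DEALS #1 (1)): ORGAN (G) «theta germ package» supplies `S` = the `K_∞`-finite `ξ`-theta germ, `T` = the theta map, `E ∕ e` = a compact-open ×
`K_∞`-type averaging operator; composition `thetaSpaceIrreducible₂_of_germ : (D) → (G) → ThetaSpaceIrreducible₂` ⇒ LD1 leaf ED. 6.  Elementary; no citation is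
load-bearing ([Dixmier1977, §13.1] for the vocabulary).  HC_CM is proved only modulo the 7 printed citations (2 remaining: hLiu418 = stmt-HodgeConjecture-24832, h413 =
stmt-HodgeConjecture-24833) until rung 0 closes; count-neutral.

## References
* [Dixmier1977] J. Dixmier, *C*-algebras* (1977), §13.1.2 (closed invariant subspaces, orthogonal complements for unitary representations), §13.1.5.
-/

set_option autoImplicit false

noncomputable section

open scoped InnerProductSpace

namespace ContRepresentation.ClosedSubrep

variable {G V : Type*} [Group G] [NormedAddCommGroup V] [InnerProductSpace ℂ V] [CompleteSpace V]
  {π : ContRepresentation ℂ G V}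

/-- For a unitary `π`, a continuous operator `E` mapping every closed invariant subspace into itself COMMUTES with the orthogonal projection onto
any closed invariant subspace `Q` (it preserves `Q` and `Qᗮ`). [cite: Dixmier1977, §13.1.2] -/
theorem starProjection_apply_of_forall_apply_mem (hπ : π.IsUnitary) (Q : ClosedSubrep π) (E : V →L[ℂ] V)
    (hE : ∀ Q' : ClosedSubrep π, ∀ v ∈ Q', E v ∈ Q') (v : V) :
    Q.toSubmodule.starProjection (E v) = E (Q.toSubmodule.starProjection v) := by
  refine Submodule.eq_starProjection_of_mem_orthogonal' (z := E (v - Q.toSubmodule.starProjection v))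
    (hE Q _ (Q.toSubmodule.starProjection_apply_mem v)) ?_ ?_
  · -- `E (v - p v) ∈ Qᗮ`: `v - p v ∈ Qᗮ = (Q.orthogonal hπ)`, which `E` preserves
    exact hE (Q.orthogonal hπ) _ (Q.toSubmodule.sub_starProjection_mem_orthogonal v)
  · rw [← map_add, add_sub_cancel]

/-- **DENSE-GERM IRREDUCIBILITY.**  Let `π` be unitary on a Hilbert space `V`, `W` a closed invariant subspace, `T : S →ₗ[ℂ] V` linear with `W ⊆ closure T(S)`
(no `T(S) ⊆ W` needed) and GERM-IRREDUCIBLE (for every closed invariant `Q`: `T(S) ⊆ Q` or `T⁻¹(Q) = 0`), `E : V →L[ℂ] V` mapping every closed invariant subspace into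
itself, `e : S →ₗ[ℂ] S` with `T ∘ e = E ∘ T` and `range e` finite-dimensional, and `E|_W ≠ 0`.  Then `W` is topologically irreducible.  (Orthogonal projection
`p` onto `Q ≤ W`; if `T(S) ⊄ Q, Qᗮ` then `p ∘ T`, `(1−p) ∘ T` are injective, `R := T(e S) ⊇ E(W)` is finite-dimensional with `pR, (1−p)R ⊆ R` of full dimension,
so `R ⊆ Q ∩ Qᗮ = 0`, `E(W) = 0`.) [cite: Dixmier1977, §13.1.2, §13.1.5] -/
theorem isTopIrreducible_of_denseGerm (hπ : π.IsUnitary) (W : ClosedSubrep π)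
    {S : Type*} [AddCommGroup S] [Module ℂ S] (T : S →ₗ[ℂ] V)
    (hdense : (W : Set V) ⊆ closure (Set.range T))
    (hgerm : ∀ Q : ClosedSubrep π, (∀ s, T s ∈ Q) ∨ (∀ s, T s ∈ Q → s = 0))
    (E : V →L[ℂ] V) (hE : ∀ Q : ClosedSubrep π, ∀ v ∈ Q, E v ∈ Q)
    (e : S →ₗ[ℂ] S) (hTe : ∀ s, T (e s) = E (T s)) (hfin : FiniteDimensional ℂ (LinearMap.range e))
    (hEW : ∃ w ∈ W, E w ≠ 0) :
    W.toContRep.IsTopIrreducible := by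
  obtain ⟨w₀, hw₀W, hw₀⟩ := hEW
  rw [isTopIrreducible_toContRep_iff]
  refine ⟨?_, fun Q hQW => ?_⟩
  · -- `W ≠ ⊥`
    rintro rfl
    exact hw₀ (by rw [(mem_bot (π := π)).1 hw₀W, map_zero])
  -- the closure of `T(S)` lies in every CLOSED set containing `T(S)`
  have hcl : ∀ Q' : ClosedSubrep π, (∀ s, T s ∈ Q') → (W : Set V) ⊆ Q' := fun Q' hQ' v hv =>
    (Q'.isClosed.closure_subset_iff.2 (by rintro _ ⟨s, rfl⟩; exact hQ' s)) (hdense hv)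
  rcases hgerm Q with hQ | hinjQ
  · -- `T(S) ⊆ Q`: then `W ⊆ Q`, so `Q = W`
    exact Or.inr (le_antisymm hQW fun v hv => hcl Q hQ hv)
  rcases hgerm (Q.orthogonal hπ) with hQ' | hinjQ'
  · -- `T(S) ⊆ Qᗮ`: then `Q ⊆ W ⊆ Qᗮ`, so `Q = ⊥`
    refine Or.inl (ext fun v => ?_)
    rw [mem_bot]
    refine ⟨fun hv => ?_, fun hv => by rw [hv]; exact Q.toSubmodule.zero_mem⟩
    have hv' : v ∈ Q.toSubmoduleᗮ := hcl _ hQ' (hQW hv)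
    exact inner_self_eq_zero.1 ((Submodule.mem_orthogonal _ v).1 hv' v hv)
  -- MAIN CASE: `T⁻¹(Q) = 0 = T⁻¹(Qᗮ)`; derive `E w₀ = 0`
  exfalso
  haveI := hfin
  set K : Submodule ℂ V := Q.toSubmodule with hK
  -- `p := K.starProjection` commutes with `E`
  have hpE : ∀ v, K.starProjection (E v) = E (K.starProjection v) :=
    starProjection_apply_of_forall_apply_mem hπ Q E hE
  -- `R := T(e S)`, finite-dimensional, hence closed
  set R : Submodule ℂ V := (LinearMap.range e).map T with hR
  haveI : FiniteDimensional ℂ R := inferInstance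
  have hRclosed : IsClosed (R : Set V) := R.closed_of_finiteDimensional
  -- `E(W) ⊆ R`: `E w ∈ cl E(T(S)) = cl T(e(S)) ⊆ cl R = R`
  have hEWR : ∀ w ∈ W, E w ∈ R := by
    intro w hw
    have h1 : E w ∈ closure (E '' Set.range T) :=
      image_closure_subset_closure_image E.continuous ⟨w, hdense hw, rfl⟩
    have h2 : E '' Set.range T ⊆ (R : Set V) := by
      rintro _ ⟨_, ⟨s, rfl⟩, rfl⟩
      change E (T s) ∈ R
      rw [← hTe]
      exact Submodule.mem_map_of_mem (LinearMap.mem_range_self e s)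
    exact hRclosed.closure_subset_iff.2 h2 h1
  -- `p R ⊆ R`: `p (T (e s)) = p (E (T s)) = E (p (T s)) ∈ E(W) ⊆ R` (`p (T s) ∈ Q ⊆ W`)
  have hpR : ∀ r ∈ R, K.starProjection r ∈ R := by
    rintro _ ⟨_, ⟨s, rfl⟩, rfl⟩
    change K.starProjection (T (e s)) ∈ R
    rw [hTe, hpE]
    exact hEWR _ (hQW (K.starProjection_apply_mem (T s)))
  -- injectivity of `p ∘ T` and `(1 - p) ∘ T` on `S`
  have hinj₁ : Function.Injective (K.starProjection.toLinearMap ∘ₗ T) := by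
    refine (injective_iff_map_eq_zero _).2 fun s hs => hinjQ' s ?_
    change K.starProjection (T s) = 0 at hs
    exact (Submodule.starProjection_apply_eq_zero_iff (K := K)).1 hs
  have hinj₂ : Function.Injective (((ContinuousLinearMap.id ℂ V) - K.starProjection).toLinearMap ∘ₗ T) := by
    refine (injective_iff_map_eq_zero _).2 fun s hs => hinjQ s ?_
    change T s - K.starProjection (T s) = 0 at hs
    exact (Submodule.starProjection_eq_self_iff (K := K)).1 (sub_eq_zero.1 hs).symm
  -- the two images `p R`, `(1 - p) R` sit inside `R` and have the dimension of `range e ≥ dim R`, hence equal `R`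
  have hdim : ∀ f : V →ₗ[ℂ] V, Function.Injective (f ∘ₗ T) → (∀ r ∈ R, f r ∈ R) → R.map f = R := by
    intro f hf hfR
    refine Submodule.eq_of_le_of_finrank_le (fun x hx => ?_) ?_
    · obtain ⟨r, hr, rfl⟩ := hx
      exact hfR r hr
    · have h1 : Module.finrank ℂ (R.map f) = Module.finrank ℂ (LinearMap.range e) := by
        rw [hR, ← Submodule.map_comp]
        exact (Submodule.equivMapOfInjective _ hf _).finrank_eq.symm
      rw [h1]
      exact Submodule.finrank_map_le T (LinearMap.range e)
  have hR₁ : R.map K.starProjection.toLinearMap = R := hdim _ hinj₁ hpR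
  have hR₂ : R.map (((ContinuousLinearMap.id ℂ V) - K.starProjection).toLinearMap) = R :=
    hdim _ hinj₂ fun r hr => by
      change r - K.starProjection r ∈ R
      exact R.sub_mem hr (hpR r hr)
  -- hence `R ⊆ Q ∩ Qᗮ = 0`
  have hR0 : ∀ r ∈ R, r = 0 := by
    intro r hr
    have h1 : r ∈ K := by
      rw [← hR₁] at hr
      obtain ⟨r', -, rfl⟩ := hr
      exact K.starProjection_apply_mem r'
    have h2 : r ∈ Kᗮ := by
      rw [← hR₂] at hr
      obtain ⟨r', -, rfl⟩ := hr
      exact K.sub_starProjection_mem_orthogonal r'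
    exact inner_self_eq_zero.1 ((Submodule.mem_orthogonal _ r).1 h2 r h1)
  exact hw₀ (hR0 _ (hEWR w₀ hw₀W))

/-- **DENSE-GERM IRREDUCIBILITY — SUBMODULE FORM** (the binder shape of LD1-plan (g2)'s organ `DenseGermIrreducibility`, ED. 2): the germ is a
SUBMODULE `S ≤ V` with `closure S = W`, germ-irreducible as `S ≤ Q ∨ S ⊓ Q = ⊥` for every closed invariant `Q`, and `E : V →L[ℂ] V` maps every
closed invariant subspace into itself, maps `S` into `S`, has `E(S)` finite-dimensional and `E|_S ≠ 0`.  Then `W` is topologically irreducible —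
`isTopIrreducible_of_denseGerm` at `T := S.subtype`, `e := E|_S` (`range e ↪ E(S)` along the subtype, so it is finite-dimensional).
[cite: Dixmier1977, §13.1.2, §13.1.5] -/
theorem isTopIrreducible_of_denseSubmoduleGerm (hπ : π.IsUnitary) (W : ClosedSubrep π) (S : Submodule ℂ V)
    (hcl : closure (S : Set V) = (W : Set V))
    (hgerm : ∀ Q : ClosedSubrep π, S ≤ Q.toSubmodule ∨ S ⊓ Q.toSubmodule = ⊥)
    (E : V →L[ℂ] V) (hE : ∀ Q : ClosedSubrep π, ∀ v ∈ Q, E v ∈ Q) (hES : ∀ v ∈ S, E v ∈ S)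
    (hfin : FiniteDimensional ℂ (S.map E.toLinearMap)) (hEW : ∃ w ∈ S, E w ≠ 0) :
    W.toContRep.IsTopIrreducible := by
  haveI := hfin
  refine isTopIrreducible_of_denseGerm hπ W S.subtype ?_ ?_ E hE (E.toLinearMap.restrict hES) (fun _ => rfl) ?_ ?_
  · -- `W = closure S ⊆ closure (range S.subtype)`
    intro v hv
    rw [← hcl] at hv
    refine closure_mono ?_ hv
    intro x hx
    exact ⟨⟨x, hx⟩, rfl⟩
  · -- germ dichotomy in the subtype currency
    intro Q
    rcases hgerm Q with h | h
    · exact Or.inl fun s => h s.2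
    · refine Or.inr fun s hs => Subtype.ext ?_
      have hs' : (s : V) ∈ S ⊓ Q.toSubmodule := ⟨s.2, hs⟩
      rw [h] at hs'
      exact (Submodule.mem_bot ℂ).1 hs'
  · -- `range (E|_S)` embeds in `E(S)`, which is finite-dimensional
    refine FiniteDimensional.of_injective
      ((S.subtype.domRestrict (LinearMap.range (E.toLinearMap.restrict hES))).codRestrict (S.map E.toLinearMap) ?_) ?_
    · rintro ⟨x, ⟨s, rfl⟩⟩
      exact Submodule.mem_map_of_mem s.2
    · intro x y hxy
      have h := congrArg Subtype.val hxy
      exact Subtype.ext (Subtype.ext h)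
  · obtain ⟨w, hw, hw0⟩ := hEW
    have h : w ∈ (W : Set V) := by rw [← hcl]; exact subset_closure hw
    exact ⟨w, h, hw0⟩

end ContRepresentation.ClosedSubrep

end
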